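import Summits.CriticalPhenomena.CardyFormulaZ2.Theorems.CardySusyWardDiscretisationFamilyExistsLegCommon
import Mathlib.Analysis.InnerProductSpace.Basic
import HarnessLib

/-!
# Local geometry at a horizontal cut edge — helper for `DiscretisationFamilyExists` (stmt-CriticalPhenomena-9644)

The part of a leg's verification that only looks at the cut edge `[u, v]`, `δu = (X₀, Y₀)`,
`δv = (X₀ + δ, Y₀)` (`X₀ = δ k₁`, `Y₀ = δ y'`), the inner cell `(k₁, y')` above it and the exit cell
`(k₁, y'-1)` below it, for ANY leg `L ⊆ ℂ` satisfying the trichotomy: every point of `L` in `Ω`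
lies on the mid-line `re = X₀ + δ/2` at height `≥ Y₀`, or in the open exit cell, or at height
`≥ Y₀ + 3δ/2`.  With the sector point `z₀ = (X₀ + δ/2, Y₀ + δ/4)` and radius `δ/8`:
the sector ball lies in `Ω` (`sectorBall_subset`), `L` meets it only on the vertical through `z₀`
(`inter_sectorBall_subset`), `δu` and `δv` are joined to the two half-balls by segments in
`Ω \ L` (`access_u_local`, `access_v_local`), and the far-pole frame boxes beyond `v` and beyond
`u` contain no point of `L ∩ Ω` (`box_v_local`, `box_u_local`).  Shared by the straight and hook
legs (`…ExistsLegC1`, `…ExistsLegC3E`).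
-/

noncomputable section

open Set Metric Complex
open Literature.Probability.LatticeModels Literature.Probability.Percolation
  Literature.Probability.LatticeModels.Mesh Literature.Probability.LatticeModels.DiscreteDobrushin

namespace Summit.CriticalPhenomena.CardyFormulaZ2.Theorems.DiscretisationFamilyExists

/-! ### Coordinates -/

/-- The centre of cell `(k, j)` in coordinates. [folklore] -/
theorem cellCenter_eq (δ : ℝ) (k j : ℤ) : cellCenter δ k j = ⟨δ * (k + 1 / 2), δ * (j + 1 / 2)⟩ := rfl

/-- The mesh vectors of the four unit directions. [folklore] -/
theorem meshPoint_cornerUnit (δ : ℝ) :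
    meshPoint δ (cornerUnit 0) = ⟨δ, 0⟩ ∧ meshPoint δ (cornerUnit 1) = ⟨0, δ⟩ ∧
      meshPoint δ (cornerUnit 2) = ⟨-δ, 0⟩ ∧ meshPoint δ (cornerUnit 3) = ⟨0, -δ⟩ := by
  refine ⟨?_, ?_, ?_, ?_⟩ <;> apply Complex.ext <;> simp [cornerUnit, meshPoint_re, meshPoint_im]

/-- The real inner product with a horizontal vector. [folklore] -/
theorem inner_horizontal (z : ℂ) (t : ℝ) : inner (ℝ) z (⟨t, 0⟩ : ℂ) = z.re * t := by
  rw [Complex.inner]; simp [Complex.mul_re]; ring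

/-- The real inner product with a vertical vector. [folklore] -/
theorem inner_vertical (z : ℂ) (t : ℝ) : inner (ℝ) z (⟨0, t⟩ : ℂ) = z.im * t := by
  rw [Complex.inner]; simp [Complex.mul_re]; ring

/-- Distance bound from coordinate bounds. [folklore] -/
theorem dist_le_of_abs_le {z w : ℂ} {a b : ℝ} (hre : |z.re - w.re| ≤ a) (him : |z.im - w.im| ≤ b) :
    dist z w ≤ a + b := by
  rw [Complex.dist_eq]
  refine (norm_le_abs_re_add_abs_im _).trans ?_
  rw [sub_re, sub_im]; exact add_le_add hre him

/-- Real part along a straight parametrisation. [folklore] -/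
theorem re_param (x y : ℂ) (θ : ℝ) : (x + θ • (y - x)).re = x.re + θ * (y.re - x.re) := by
  simp only [add_re, Complex.real_smul, mul_re, ofReal_re, ofReal_im, zero_mul, sub_zero, sub_re]

/-- Imaginary part along a straight parametrisation. [folklore] -/
theorem im_param (x y : ℂ) (θ : ℝ) : (x + θ • (y - x)).im = x.im + θ * (y.im - x.im) := by
  simp only [add_im, Complex.real_smul, mul_im, ofReal_re, ofReal_im, zero_mul, add_zero, sub_im]

/-! ### The local picture at a horizontal cut edge -/

section Local

variable {Ω : Set ℂ} {δ X₀ Y₀ : ℝ} {k₁ y' : ℤ} {L : Set ℂ}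

/-- **The sector ball lies in `Ω`** (inside the inner cell above the cut edge). [folklore] -/
theorem sectorBall_subset (hδ : 0 < δ) (hX : X₀ = δ * k₁) (hY : Y₀ = δ * y')
    (hfull : cell δ k₁ y' ⊆ Ω) : ball (⟨X₀ + δ / 2, Y₀ + δ / 4⟩ : ℂ) (δ / 8) ⊆ Ω := by
  intro z hz
  rw [mem_ball, Complex.dist_eq] at hz
  have hre := (abs_re_le_norm (z - ⟨X₀ + δ / 2, Y₀ + δ / 4⟩)).trans_lt hz
  have him := (abs_im_le_norm (z - ⟨X₀ + δ / 2, Y₀ + δ / 4⟩)).trans_lt hz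
  rw [sub_re, abs_lt] at hre
  rw [sub_im, abs_lt] at him
  simp only at hre him
  refine hfull (mem_cell_iff.2 ⟨⟨by linarith, by linarith⟩, by linarith, by linarith⟩)

/-- **The leg meets the sector ball only on the vertical through `z₀`.** [folklore] -/
theorem inter_sectorBall_subset (hδ : 0 < δ) (hX : X₀ = δ * k₁) (hY : Y₀ = δ * y')
    (hfull : cell δ k₁ y' ⊆ Ω) {u v : Site 2} (hueq : meshPoint δ u = ⟨X₀, Y₀⟩)
    (hveq : meshPoint δ v = ⟨X₀ + δ, Y₀⟩)
    (htri : ∀ z ∈ L, z ∈ Ω → (z.re = X₀ + δ / 2 ∧ Y₀ ≤ z.im) ∨ z ∈ cell δ k₁ (y' - 1) ∨ Y₀ + δ * (3 / 2) ≤ z.im) :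
    L ∩ ball (⟨X₀ + δ / 2, Y₀ + δ / 4⟩ : ℂ) (δ / 8) ⊆
      {z | inner (ℝ) (z - ⟨X₀ + δ / 2, Y₀ + δ / 4⟩) (meshPoint δ v - meshPoint δ u) = 0} := by
  rintro z ⟨hz1, hz2⟩
  have hvu : meshPoint δ v - meshPoint δ u = ⟨δ, 0⟩ := by rw [hueq, hveq]; apply Complex.ext <;> simp
  rw [mem_setOf_eq, hvu, inner_horizontal]
  have hzΩ : z ∈ Ω := sectorBall_subset hδ hX hY hfull hz2
  rw [mem_ball, Complex.dist_eq] at hz2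
  have him := (abs_im_le_norm (z - ⟨X₀ + δ / 2, Y₀ + δ / 4⟩)).trans_lt hz2
  rw [sub_im, abs_lt] at him
  simp only at him
  rcases htri z hz1 hzΩ with ⟨hre, -⟩ | h | h
  · rw [sub_re, hre]; simp
  · rw [mem_cell_iff] at h; push_cast at h; exfalso; linarith [h.2.2]
  · exfalso; linarith

/-- **Access from `u`**: the point `q = z₀ - (δ/16, 0)` of the western half-ball is joined to `δu`
by a segment inside `Ω` avoiding the leg. [folklore] -/
theorem access_u_local (hδ : 0 < δ) (hX : X₀ = δ * k₁) (hY : Y₀ = δ * y')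
    (hfull : cell δ k₁ y' ⊆ Ω) {u v : Site 2} (hueq : meshPoint δ u = ⟨X₀, Y₀⟩)
    (hveq : meshPoint δ v = ⟨X₀ + δ, Y₀⟩) (huΩ : meshPoint δ u ∈ Ω)
    (htri : ∀ z ∈ L, z ∈ Ω → (z.re = X₀ + δ / 2 ∧ Y₀ ≤ z.im) ∨ z ∈ cell δ k₁ (y' - 1) ∨ Y₀ + δ * (3 / 2) ≤ z.im) :
    ∃ q ∈ ball (⟨X₀ + δ / 2, Y₀ + δ / 4⟩ : ℂ) (δ / 8),
      0 < inner (ℝ) (q - ⟨X₀ + δ / 2, Y₀ + δ / 4⟩) (meshPoint δ u - meshPoint δ v) ∧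
      segment ℝ (meshPoint δ u) q ⊆ Ω \ L := by
  have huv : meshPoint δ u - meshPoint δ v = ⟨-δ, 0⟩ := by rw [hueq, hveq]; apply Complex.ext <;> simp
  refine ⟨⟨X₀ + δ / 2 - δ / 16, Y₀ + δ / 4⟩, ?_, ?_, ?_⟩
  · rw [mem_ball, Complex.dist_eq]
    rw [show (⟨X₀ + δ / 2 - δ / 16, Y₀ + δ / 4⟩ : ℂ) - ⟨X₀ + δ / 2, Y₀ + δ / 4⟩ = ((-(δ / 16) : ℝ) : ℂ) by
      apply Complex.ext <;> simp]
    rw [Complex.norm_real, Real.norm_eq_abs, abs_of_neg (by linarith)]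
    linarith
  · rw [huv, inner_horizontal, sub_re]
    simp only
    nlinarith [sq_pos_of_pos hδ]
  · intro z hz
    rw [segment_eq_image'] at hz
    obtain ⟨θ, ⟨h0, h1⟩, rfl⟩ := hz
    rw [hueq]
    have hre : ((⟨X₀, Y₀⟩ : ℂ) + θ • ((⟨X₀ + δ / 2 - δ / 16, Y₀ + δ / 4⟩ : ℂ) - ⟨X₀, Y₀⟩)).re =
        X₀ + θ * (δ * (7 / 16)) := by rw [re_param]; simp only; ring
    have him : ((⟨X₀, Y₀⟩ : ℂ) + θ • ((⟨X₀ + δ / 2 - δ / 16, Y₀ + δ / 4⟩ : ℂ) - ⟨X₀, Y₀⟩)).im =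
        Y₀ + θ * (δ / 4) := by rw [im_param]; simp only; ring
    have hθδ0 : 0 ≤ θ * δ := mul_nonneg h0 hδ.le
    have hθδ1 : θ * δ ≤ δ := mul_le_of_le_one_left hδ.le h1
    have hwΩ : (⟨X₀, Y₀⟩ : ℂ) + θ • ((⟨X₀ + δ / 2 - δ / 16, Y₀ + δ / 4⟩ : ℂ) - ⟨X₀, Y₀⟩) ∈ Ω := by
      rcases eq_or_lt_of_le h0 with h | h
      · rw [← h, zero_smul, add_zero, ← hueq]; exact huΩ
      · have hθδpos : 0 < θ * δ := mul_pos h hδ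
        refine hfull (mem_cell_iff.2 ⟨⟨?_, ?_⟩, ?_, ?_⟩) <;> (first | rw [hre] | rw [him]) <;> linarith
    refine ⟨hwΩ, fun hmem => ?_⟩
    rcases htri _ hmem hwΩ with ⟨hre', -⟩ | h | h
    · rw [hre] at hre'; linarith
    · rw [mem_cell_iff] at h; push_cast at h
      have := h.2.2; rw [him] at this; linarith
    · rw [him] at h; linarith

/-- **Access from `v`**: the point `q = z₀ + (δ/16, 0)` of the eastern half-ball is joined to `δv`
by a segment inside `Ω` avoiding the leg. [folklore] -/
theorem access_v_local (hδ : 0 < δ) (hX : X₀ = δ * k₁) (hY : Y₀ = δ * y')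
    (hfull : cell δ k₁ y' ⊆ Ω) {u v : Site 2} (hueq : meshPoint δ u = ⟨X₀, Y₀⟩)
    (hveq : meshPoint δ v = ⟨X₀ + δ, Y₀⟩) (hvΩ : meshPoint δ v ∈ Ω)
    (htri : ∀ z ∈ L, z ∈ Ω → (z.re = X₀ + δ / 2 ∧ Y₀ ≤ z.im) ∨ z ∈ cell δ k₁ (y' - 1) ∨ Y₀ + δ * (3 / 2) ≤ z.im) :
    ∃ q ∈ ball (⟨X₀ + δ / 2, Y₀ + δ / 4⟩ : ℂ) (δ / 8),
      0 < inner (ℝ) (q - ⟨X₀ + δ / 2, Y₀ + δ / 4⟩) (meshPoint δ v - meshPoint δ u) ∧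
      segment ℝ (meshPoint δ v) q ⊆ Ω \ L := by
  have hvu : meshPoint δ v - meshPoint δ u = ⟨δ, 0⟩ := by rw [hueq, hveq]; apply Complex.ext <;> simp
  refine ⟨⟨X₀ + δ / 2 + δ / 16, Y₀ + δ / 4⟩, ?_, ?_, ?_⟩
  · rw [mem_ball, Complex.dist_eq]
    rw [show (⟨X₀ + δ / 2 + δ / 16, Y₀ + δ / 4⟩ : ℂ) - ⟨X₀ + δ / 2, Y₀ + δ / 4⟩ = (((δ / 16) : ℝ) : ℂ) by
      apply Complex.ext <;> simp]
    rw [Complex.norm_real, Real.norm_eq_abs, abs_of_pos (by positivity)]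
    linarith
  · rw [hvu, inner_horizontal, sub_re]
    simp only
    nlinarith [sq_pos_of_pos hδ]
  · intro z hz
    rw [segment_eq_image'] at hz
    obtain ⟨θ, ⟨h0, h1⟩, rfl⟩ := hz
    rw [hveq]
    have hre : ((⟨X₀ + δ, Y₀⟩ : ℂ) + θ • ((⟨X₀ + δ / 2 + δ / 16, Y₀ + δ / 4⟩ : ℂ) - ⟨X₀ + δ, Y₀⟩)).re =
        X₀ + δ - θ * (δ * (7 / 16)) := by rw [re_param]; simp only; ring
    have him : ((⟨X₀ + δ, Y₀⟩ : ℂ) + θ • ((⟨X₀ + δ / 2 + δ / 16, Y₀ + δ / 4⟩ : ℂ) - ⟨X₀ + δ, Y₀⟩)).im =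
        Y₀ + θ * (δ / 4) := by rw [im_param]; simp only; ring
    have hθδ0 : 0 ≤ θ * δ := mul_nonneg h0 hδ.le
    have hθδ1 : θ * δ ≤ δ := mul_le_of_le_one_left hδ.le h1
    have hwΩ : (⟨X₀ + δ, Y₀⟩ : ℂ) + θ • ((⟨X₀ + δ / 2 + δ / 16, Y₀ + δ / 4⟩ : ℂ) - ⟨X₀ + δ, Y₀⟩) ∈ Ω := by
      rcases eq_or_lt_of_le h0 with h | h
      · rw [← h, zero_smul, add_zero, ← hveq]; exact hvΩ
      · have hθδpos : 0 < θ * δ := mul_pos h hδ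
        refine hfull (mem_cell_iff.2 ⟨⟨?_, ?_⟩, ?_, ?_⟩) <;> (first | rw [hre] | rw [him]) <;> linarith
    refine ⟨hwΩ, fun hmem => ?_⟩
    rcases htri _ hmem hwΩ with ⟨hre', -⟩ | h | h
    · rw [hre] at hre'; linarith
    · rw [mem_cell_iff] at h; push_cast at h
      have := h.2.2; rw [him] at this; linarith
    · rw [him] at h; linarith

/-- **The far-pole frame box beyond `v` is free** of points of `L ∩ Ω`. [folklore] -/
theorem box_v_local (hδ : 0 < δ) (hX : X₀ = δ * k₁) {v : Site 2}
    (hveq : meshPoint δ v = ⟨X₀ + δ, Y₀⟩)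
    (htri : ∀ z ∈ L, z ∈ Ω → (z.re = X₀ + δ / 2 ∧ Y₀ ≤ z.im) ∨ z ∈ cell δ k₁ (y' - 1) ∨ Y₀ + δ * (3 / 2) ≤ z.im) :
    ∀ z ∈ L, z ∈ Ω → ∀ α β : ℝ, 0 ≤ α → α ≤ 2 → -1 ≤ β → β ≤ 1 →
      z ≠ meshPoint δ v + α • meshPoint δ (cornerUnit 0) + β • meshPoint δ (cornerUnit (0 + 1)) := by
  obtain ⟨e0, e1, -, -⟩ := meshPoint_cornerUnit δ
  intro z hz hzΩ α β h0 h2 hb1 hb2 heq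
  have hre := congrArg Complex.re heq
  have him := congrArg Complex.im heq
  rw [show (0 : Fin 4) + 1 = 1 by decide, hveq, e0, e1] at hre him
  simp only [add_re, Complex.real_smul, mul_re, ofReal_re, ofReal_im, zero_mul, sub_zero] at hre
  simp only [add_im, Complex.real_smul, mul_im, ofReal_re, ofReal_im, zero_mul, add_zero] at him
  have hαδ : 0 ≤ α * δ := mul_nonneg h0 hδ.le
  have hβδ : β * δ ≤ δ := by nlinarith
  rcases htri z hz hzΩ with ⟨hre', -⟩ | h | h
  · rw [hre'] at hre; linarith
  · rw [mem_cell_iff] at h; push_cast at h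
    have := h.1.2; rw [hre] at this; linarith
  · rw [him] at h; linarith

/-- **The far-pole frame box beyond `u` is free** of points of `L ∩ Ω`. [folklore] -/
theorem box_u_local (hδ : 0 < δ) (hX : X₀ = δ * k₁) {u : Site 2}
    (hueq : meshPoint δ u = ⟨X₀, Y₀⟩)
    (htri : ∀ z ∈ L, z ∈ Ω → (z.re = X₀ + δ / 2 ∧ Y₀ ≤ z.im) ∨ z ∈ cell δ k₁ (y' - 1) ∨ Y₀ + δ * (3 / 2) ≤ z.im) :
    ∀ z ∈ L, z ∈ Ω → ∀ α β : ℝ, 0 ≤ α → α ≤ 2 → -1 ≤ β → β ≤ 1 →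
      z ≠ meshPoint δ u + α • meshPoint δ (cornerUnit (0 + 2)) + β • meshPoint δ (cornerUnit (0 + 2 + 1)) := by
  obtain ⟨-, -, e2, e3⟩ := meshPoint_cornerUnit δ
  intro z hz hzΩ α β h0 h2 hb1 hb2 heq
  have hre := congrArg Complex.re heq
  have him := congrArg Complex.im heq
  rw [show (0 : Fin 4) + 2 = 2 by decide, show (2 : Fin 4) + 1 = 3 by decide, hueq, e2, e3] at hre him
  simp only [add_re, Complex.real_smul, mul_re, ofReal_re, ofReal_im, zero_mul, sub_zero] at hre
  simp only [add_im, Complex.real_smul, mul_im, ofReal_re, ofReal_im, zero_mul, add_zero] at him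
  have hαδ : 0 ≤ α * δ := mul_nonneg h0 hδ.le
  have hβδ : -δ ≤ β * δ := by nlinarith
  rcases htri z hz hzΩ with ⟨hre', -⟩ | h | h
  · rw [hre'] at hre; linarith
  · rw [mem_cell_iff] at h; push_cast at h
    have := h.1.1; rw [hre] at this; linarith
  · rw [him] at h; linarith

end Local

end Summit.CriticalPhenomena.CardyFormulaZ2.Theorems.DiscretisationFamilyExists

end
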